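/-
Copyright (c) 2026. All rights reserved.
Released under Apache 2.0 license as described in the file LICENSE.
Authors: abc-iut cell, seat abc-iut-w5-d019 (gen 8).
-/
import Mathlib.GroupTheory.Index
import Mathlib.GroupTheory.OrderOfElement
import Mathlib.GroupTheory.SpecificGroups.Cyclic
import Mathlib.Algebra.Group.Subgroup.Pointwise

/-!
# A normal subgroup with metacyclic quotient is normally generated by `d + 4` elements

Let `G` be a group generated by the entries `a₁, …, a_d` of a list `l`, and let `N ⊴ G` be a normal
subgroup of finite index whose quotient is METACYCLIC in the following concrete sense: there are a
normal subgroup `A ⊴ G` and elements `t ∈ A`, `s` with `N ≤ A ≤ N·⟨t⟩` and `G = A·⟨s⟩` (`A/N` and `G/A`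
cyclic).  Then `N` is the normal closure of `d + 4` explicit elements of `N`
(`exists_normalGenerators`): the "corrections" `nᵢ = aᵢ wᵢ⁻¹ ∈ N` of the generators (`wᵢ` a word in
`t, s`) together with the four "relators" `t^{[A:N]}`, `(s t s⁻¹) t^{-q}`, `(s⁻¹ t s) t^{-q'}`,
`s^{[G:A]} t^{-j}` — because modulo their normal closure `M` the group is generated by `t̄, s̄` with
`⟨t̄⟩` normal of order `∣ [A:N]` and cyclic quotient of order `∣ [G:A]`, so `[G:M] ∣ [G:N]` forces
`M = N`.  Elementary counting; it replaces, for the wild inertia group `G₁ ⊴ Gal(E/k)` of a finite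
Galois extension of local fields (`Gal/G₁` metacyclic), the finite normal generation that the
Jannsen–Wingberg structure theorem would give, UNIFORMLY in `E` (`d + 4` normal generators where `d`
bounds the number of generators of `Gal(E/k)`).

Consumer (cell abc-iut, GAP-LEDGER G-L3d2g2-1): the list `v` of `CommutatorWidthNilpotentNormal.lean` /
`CommutatorWidthNilpotentByMetacyclic.lean` (uniform commutator width of `Gal(E/k)`, whence closedness of
the derived subgroup of `G_k` and strong completeness).  Classical; no definition, no instance; nothing
here bears on [IUTchIII] Cor. 3.12 or asserts anything about abc.

[cite: RibesZalesskii2010, §4.2] [cite: DDMSAnalyticProP1999, Prop 1.19 (proof)]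
-/

namespace Literature.GroupTheory

namespace MetacyclicNormalGenerators

variable {G : Type*} [Group G]

/-- Conjugation commutes with integer powers: `g x^k g⁻¹ = (g x g⁻¹)^k`.
[cite: RibesZalesskii2010, §4.2] -/
theorem conj_zpow_eq (g x : G) (k : ℤ) : g * x ^ k * g⁻¹ = (g * x * g⁻¹) ^ k :=
  conj_zpow.symm

/-- **Normal generation of a normal subgroup with metacyclic quotient.**  Let the entries of `l`
generate `G`; let `N ⊴ G` have finite index, `A ⊴ G`, `t ∈ A` with `N ≤ A ≤ N ⊔ ⟨t⟩`, and
`A ⊔ ⟨s⟩ = G`.  Then `N` is the normal closure of `l.length + 4` elements of `N`.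
[cite: RibesZalesskii2010, §4.2] -/
theorem exists_normalGenerators (N A : Subgroup G) [N.Normal] [A.Normal] [N.FiniteIndex]
    (hNA : N ≤ A) {t : G} (ht : t ∈ A) (hAt : A ≤ N ⊔ Subgroup.zpowers t) {s : G}
    (hs : A ⊔ Subgroup.zpowers s = ⊤) {l : List G} (hl : Subgroup.closure {a : G | a ∈ l} = ⊤) :
    ∃ v : List G, v.length = l.length + 4 ∧ (∀ b ∈ v, b ∈ N) ∧
      N ≤ Subgroup.normalClosure {b : G | b ∈ v} := by
  classical
  -- every `g` is `n · w` with `n ∈ N` and `w` a word in `t, s`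
  have hzt : Subgroup.zpowers t ≤ Subgroup.closure ({t, s} : Set G) :=
    (Subgroup.zpowers_le).mpr (Subgroup.subset_closure (by simp))
  have hzs : Subgroup.zpowers s ≤ Subgroup.closure ({t, s} : Set G) :=
    (Subgroup.zpowers_le).mpr (Subgroup.subset_closure (by simp))
  have hdec : ∀ g : G, ∃ n ∈ N, ∃ w ∈ Subgroup.closure ({t, s} : Set G), n * w = g := by
    intro g
    have hg : g ∈ A ⊔ Subgroup.zpowers s := by rw [hs]; exact Subgroup.mem_top g
    obtain ⟨a, ha, z, hz, rfl⟩ := Subgroup.mem_sup_of_normal_left.mp hg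
    obtain ⟨n, hn, y, hy, rfl⟩ := Subgroup.mem_sup_of_normal_left.mp (hAt ha)
    exact ⟨n, hn, y * z, Subgroup.mul_mem _ (hzt hy) (hzs hz), by rw [mul_assoc]⟩
  choose nf hnfN wf hwf hnw using hdec
  -- the relators
  obtain ⟨n₂, hn₂, y₂, hy₂, h₂⟩ :=
    Subgroup.mem_sup_of_normal_left.mp (hAt (Subgroup.Normal.conj_mem ‹A.Normal› t ht s))
  obtain ⟨n₄, hn₄, y₄, hy₄, h₄⟩ :=
    Subgroup.mem_sup_of_normal_left.mp (hAt (Subgroup.Normal.conj_mem ‹A.Normal› t ht s⁻¹))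
  obtain ⟨n₃, hn₃, y₃, hy₃, h₃⟩ := Subgroup.mem_sup_of_normal_left.mp (hAt (A.pow_index_mem s))
  obtain ⟨k₂, rfl⟩ := Subgroup.mem_zpowers_iff.mp hy₂
  obtain ⟨k₄, rfl⟩ := Subgroup.mem_zpowers_iff.mp hy₄
  obtain ⟨k₃, rfl⟩ := Subgroup.mem_zpowers_iff.mp hy₃
  have ht₁ : t ^ N.relIndex A ∈ N := N.pow_relIndex_mem ht
  refine ⟨l.map nf ++ [t ^ N.relIndex A, n₂, n₃, n₄], by simp, ?_, ?_⟩
  · intro b hb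
    rcases List.mem_append.mp hb with hb | hb
    · obtain ⟨a, _, rfl⟩ := List.mem_map.mp hb
      exact hnfN a
    · simp only [List.mem_cons, List.not_mem_nil, or_false] at hb
      rcases hb with rfl | rfl | rfl | rfl
      exacts [ht₁, hn₂, hn₃, hn₄]
  -- `M`, the normal closure, and the projection `π : G → G ⧸ M`
  · have hvN : {b : G | b ∈ l.map nf ++ [t ^ N.relIndex A, n₂, n₃, n₄]} ⊆ (N : Set G) := by
      intro b hb
      rcases List.mem_append.mp hb with hb | hb
      · obtain ⟨a, _, rfl⟩ := List.mem_map.mp hb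
        exact hnfN a
      · simp only [List.mem_cons, List.not_mem_nil, or_false] at hb
        rcases hb with rfl | rfl | rfl | rfl
        exacts [ht₁, hn₂, hn₃, hn₄]
    generalize hM : Subgroup.normalClosure
      {b : G | b ∈ l.map nf ++ [t ^ N.relIndex A, n₂, n₃, n₄]} = M
    haveI : M.Normal := by rw [← hM]; infer_instance
    have hMN : M ≤ N := by rw [← hM]; exact Subgroup.normalClosure_le_normal hvN
    have hmemM : ∀ b ∈ l.map nf ++ [t ^ N.relIndex A, n₂, n₃, n₄], b ∈ M := fun b hb => by
      rw [← hM]; exact Subgroup.subset_normalClosure hb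
    have h1 : t ^ N.relIndex A ∈ M := hmemM _ (by simp)
    have h2 : n₂ ∈ M := hmemM _ (by simp)
    have h3 : n₃ ∈ M := hmemM _ (by simp)
    have h4 : n₄ ∈ M := hmemM _ (by simp)
    have hπ1 : ∀ {b : G}, b ∈ M → QuotientGroup.mk' M b = 1 := fun hb => by
      rw [QuotientGroup.mk'_apply, QuotientGroup.eq_one_iff]; exact hb
    -- `G ⧸ M` is generated by the images of `t` and `s`
    have hgenQ : ∀ x : G ⧸ M,
        x ∈ Subgroup.closure ({QuotientGroup.mk' M t, QuotientGroup.mk' M s} : Set (G ⧸ M)) := by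
      have himg : (Subgroup.closure ({t, s} : Set G)).map (QuotientGroup.mk' M) =
          Subgroup.closure ({QuotientGroup.mk' M t, QuotientGroup.mk' M s} : Set (G ⧸ M)) := by
        rw [MonoidHom.map_closure, Set.image_pair]
      intro x
      induction x using QuotientGroup.induction_on with
      | H g =>
        have hg : g ∈ Subgroup.closure {a : G | a ∈ l} := by rw [hl]; exact Subgroup.mem_top g
        change QuotientGroup.mk' M g ∈ _
        refine Subgroup.closure_induction (p := fun g _ => QuotientGroup.mk' M g ∈
          Subgroup.closure ({QuotientGroup.mk' M t, QuotientGroup.mk' M s} : Set (G ⧸ M)))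
          ?_ ?_ ?_ ?_ hg
        · intro a ha
          have hma : nf a ∈ M := hmemM _ (List.mem_append_left _ (List.mem_map.mpr ⟨a, ha, rfl⟩))
          have hga : QuotientGroup.mk' M (nf a * wf a) = QuotientGroup.mk' M (wf a) := by
            rw [map_mul, hπ1 hma, one_mul]
          rw [hnw a] at hga
          rw [hga, ← himg]
          exact Subgroup.mem_map_of_mem _ (hwf a)
        · rw [map_one]; exact Subgroup.one_mem _
        · intro x y _ _ hx hy
          rw [map_mul]; exact Subgroup.mul_mem _ hx hy
        · intro x _ hx
          rw [map_inv]; exact Subgroup.inv_mem _ hx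
    -- the relations in `G ⧸ M`
    have r₁ : QuotientGroup.mk' M t ^ N.relIndex A = 1 := by rw [← map_pow]; exact hπ1 h1
    have r₂ : QuotientGroup.mk' M s * QuotientGroup.mk' M t * (QuotientGroup.mk' M s)⁻¹ =
        QuotientGroup.mk' M t ^ k₂ := by
      have := congrArg (QuotientGroup.mk' M) h₂
      simp only [map_mul, map_inv, map_zpow, hπ1 h2, one_mul] at this
      exact this.symm
    have r₄ : (QuotientGroup.mk' M s)⁻¹ * QuotientGroup.mk' M t * QuotientGroup.mk' M s =
        QuotientGroup.mk' M t ^ k₄ := by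
      have := congrArg (QuotientGroup.mk' M) h₄
      simp only [map_mul, map_inv, map_zpow, hπ1 h4, one_mul, inv_inv] at this
      exact this.symm
    have r₃ : QuotientGroup.mk' M s ^ A.index = QuotientGroup.mk' M t ^ k₃ := by
      have := congrArg (QuotientGroup.mk' M) h₃
      simp only [map_mul, map_pow, map_zpow, hπ1 h3, one_mul] at this
      exact this.symm
    -- `T = ⟨t̄⟩` is normal in `G ⧸ M`
    have hkey : ∀ x : G ⧸ M, (∀ y ∈ Subgroup.zpowers (QuotientGroup.mk' M t),
        x * y * x⁻¹ ∈ Subgroup.zpowers (QuotientGroup.mk' M t)) ∧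
        (∀ y ∈ Subgroup.zpowers (QuotientGroup.mk' M t),
        x⁻¹ * y * x ∈ Subgroup.zpowers (QuotientGroup.mk' M t)) := by
      intro x
      refine Subgroup.closure_induction (p := fun x _ =>
        (∀ y ∈ Subgroup.zpowers (QuotientGroup.mk' M t),
          x * y * x⁻¹ ∈ Subgroup.zpowers (QuotientGroup.mk' M t)) ∧
        (∀ y ∈ Subgroup.zpowers (QuotientGroup.mk' M t),
          x⁻¹ * y * x ∈ Subgroup.zpowers (QuotientGroup.mk' M t))) ?_ ?_ ?_ ?_ (hgenQ x)
      · intro g hg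
        simp only [Set.mem_insert_iff, Set.mem_singleton_iff] at hg
        rcases hg with rfl | rfl
        · -- conjugation by `t̄` preserves `⟨t̄⟩`
          exact ⟨fun y hy => Subgroup.mul_mem _ (Subgroup.mul_mem _ (Subgroup.mem_zpowers _) hy)
              (Subgroup.inv_mem _ (Subgroup.mem_zpowers _)),
            fun y hy => Subgroup.mul_mem _ (Subgroup.mul_mem _
              (Subgroup.inv_mem _ (Subgroup.mem_zpowers _)) hy) (Subgroup.mem_zpowers _)⟩
        · -- conjugation by `s̄^{±1}`: the relations `r₂`, `r₄`
          refine ⟨fun y hy => ?_, fun y hy => ?_⟩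
          · obtain ⟨k, rfl⟩ := Subgroup.mem_zpowers_iff.mp hy
            rw [conj_zpow_eq, r₂, ← zpow_mul]
            exact Subgroup.zpow_mem _ (Subgroup.mem_zpowers _) _
          · obtain ⟨k, rfl⟩ := Subgroup.mem_zpowers_iff.mp hy
            have e : (QuotientGroup.mk' M s)⁻¹ * QuotientGroup.mk' M t ^ k * QuotientGroup.mk' M s =
                ((QuotientGroup.mk' M s)⁻¹ * QuotientGroup.mk' M t * QuotientGroup.mk' M s) ^ k := by
              simpa using conj_zpow_eq (QuotientGroup.mk' M s)⁻¹ (QuotientGroup.mk' M t) k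
            rw [e, r₄, ← zpow_mul]
            exact Subgroup.zpow_mem _ (Subgroup.mem_zpowers _) _
      · exact ⟨fun y hy => by simpa using hy, fun y hy => by simpa using hy⟩
      · intro x x' _ _ hx hx'
        refine ⟨fun y hy => ?_, fun y hy => ?_⟩
        · have : x * x' * y * (x * x')⁻¹ = x * (x' * y * x'⁻¹) * x⁻¹ := by group
          rw [this]; exact hx.1 _ (hx'.1 y hy)
        · have : (x * x')⁻¹ * y * (x * x') = x'⁻¹ * (x⁻¹ * y * x) * x' := by group
          rw [this]; exact hx'.2 _ (hx.2 y hy)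
      · intro x _ hx
        refine ⟨fun y hy => ?_, fun y hy => ?_⟩
        · simpa using hx.2 y hy
        · simpa using hx.1 y hy
    haveI hTn : (Subgroup.zpowers (QuotientGroup.mk' M t)).Normal := ⟨fun y hy x => (hkey x).1 y hy⟩
    -- counting: `|⟨t̄⟩| ∣ [A:N]` and `[G ⧸ M : ⟨t̄⟩] ∣ [G:A]`
    have hordt : orderOf (QuotientGroup.mk' M t) ∣ N.relIndex A := orderOf_dvd_of_pow_eq_one r₁
    have hρt : QuotientGroup.mk' (Subgroup.zpowers (QuotientGroup.mk' M t)) (QuotientGroup.mk' M t) = 1 :=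
      (QuotientGroup.eq_one_iff _).mpr (Subgroup.mem_zpowers _)
    have hgen2 : Subgroup.zpowers (QuotientGroup.mk' (Subgroup.zpowers (QuotientGroup.mk' M t))
        (QuotientGroup.mk' M s)) = ⊤ := by
      rw [eq_top_iff]
      intro q _
      induction q using QuotientGroup.induction_on with
      | H x =>
        have hx := Subgroup.mem_map_of_mem
          (QuotientGroup.mk' (Subgroup.zpowers (QuotientGroup.mk' M t))) (hgenQ x)
        rw [MonoidHom.map_closure, Set.image_pair, hρt] at hx
        refine (Subgroup.closure_le _).mpr ?_ hx
        intro y hy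
        simp only [Set.mem_insert_iff, Set.mem_singleton_iff] at hy
        rcases hy with rfl | rfl
        · exact Subgroup.one_mem _
        · exact Subgroup.mem_zpowers _
    have hords : orderOf (QuotientGroup.mk' (Subgroup.zpowers (QuotientGroup.mk' M t))
        (QuotientGroup.mk' M s)) ∣ A.index := by
      refine orderOf_dvd_of_pow_eq_one ?_
      rw [← map_pow, r₃, map_zpow, hρt, one_zpow]
    have hcardT : Nat.card (Subgroup.zpowers (QuotientGroup.mk' M t)) =
        orderOf (QuotientGroup.mk' M t) := Nat.card_zpowers _
    have hindexT : (Subgroup.zpowers (QuotientGroup.mk' M t)).index =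
        orderOf (QuotientGroup.mk' (Subgroup.zpowers (QuotientGroup.mk' M t))
          (QuotientGroup.mk' M s)) := by
      rw [Subgroup.index_eq_card, ← Nat.card_zpowers, hgen2, Subgroup.card_top]
    have hdvd : M.index ∣ N.index := by
      rw [Subgroup.index_eq_card M, ← Subgroup.card_mul_index (Subgroup.zpowers (QuotientGroup.mk' M t)),
        hcardT, hindexT, ← Subgroup.relIndex_mul_index hNA]
      exact mul_dvd_mul hordt hords
    -- hence `M = N`
    have hmul := Subgroup.relIndex_mul_index hMN
    have hN0 : N.index ≠ 0 := Subgroup.FiniteIndex.index_ne_zero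
    have hM0 : M.index ≠ 0 := fun h0 => hN0 (Nat.eq_zero_of_zero_dvd (h0 ▸ hdvd))
    have hle : M.relIndex N * N.index ≤ 1 * N.index := by
      rw [hmul, one_mul]; exact Nat.le_of_dvd (Nat.pos_of_ne_zero hN0) hdvd
    have hrel : M.relIndex N ≤ 1 := Nat.le_of_mul_le_mul_right hle (Nat.pos_of_ne_zero hN0)
    have hrel0 : M.relIndex N ≠ 0 := fun h0 => by rw [h0, zero_mul] at hmul; exact hM0 hmul.symm
    have hrel1 : M.relIndex N = 1 := by omega
    exact Subgroup.relIndex_eq_one.mp hrel1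

end MetacyclicNormalGenerators

end Literature.GroupTheory
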